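import Mathlib
import Literature.Analysis.OperatorTheory.ContractiveDetComplexity
import HarnessLib

/-!
# Crux `PriceOfContractivity` (stmt-ValiantsHypothesis-10583), line `birth` — partial case
`stub_sameSize_monochromeBlocks`

Block-upper-triangular `K₀` along a rank function `r : Fin R → ℕ` (`K₀ i j = 0` when
`r j < r i`) whose diagonal blocks are monochrome (`κ` constant on each level set of `r`).
The Sylvester pencil only sees the diagonal blocks: evaluated at a point `z`, the scalar pencil
`1 + diagonal (z ∘ κ) * K₀` is block triangular along `r` (`Matrix.BlockTriangular.det`), and its
block at level `a` is the one-colour pencil `1 + t • K₀[r = a]`, `t` the common value of `z ∘ κ`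
on the block, whose determinant is `∏ (1 + t λ)` over the roots `λ` of the characteristic
polynomial of the block (`1 + t M = (-t) • (scalar (-t⁻¹) - M)` and `Matrix.eval_charpoly`).
Zero-freeness at the constant points `z ≡ t`, `‖t‖ ≤ 2`, forces `‖λ‖ ≤ 1/2` (test
`t = -λ⁻¹`).  The witness is `K₁ := diagonal d`, `d` listing the block eigenvalues row by row,
with the same colouring `κ₁ := κ`: the two pencil determinants agree at every point, hence as
polynomials (`MvPolynomial.funext`), and `‖diagonal d‖ = max ‖d i‖ ≤ 1/2`
(`Matrix.l2_opNorm_diagonal`).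
-/

-- `Summit.<Summit>.<Problem>` repeats `ValiantsHypothesis` by the tree's layout convention (D-0017).
set_option linter.dupNamespace false

namespace Summit.ValiantsHypothesis.ValiantsHypothesis.Theorems.PriceOfContractivity.MonochromeBlocks

open Matrix
open scoped Matrix.Norms.L2Operator

/-- Over `ℂ` the characteristic polynomial of an `m × m` matrix has exactly `card m` roots
(counted with multiplicity). [folklore] -/
theorem card_roots_charpoly {m : Type*} [Fintype m] [DecidableEq m] (M : Matrix m m ℂ) :
    M.charpoly.roots.card = Fintype.card m := by
  rw [Polynomial.splits_iff_card_roots.mp (IsAlgClosed.splits M.charpoly),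
    Matrix.charpoly_natDegree_eq_dim]

/-- `det (1 + t M) = ∏ (1 + t λ)` over the roots `λ` of the characteristic polynomial of a complex
square matrix `M`, with multiplicity (`1 + t M = (-t) • (t⁻¹ + M)` for `t ≠ 0`). [folklore] -/
theorem det_one_add_smul_eq_prod_roots {m : Type*} [Fintype m] [DecidableEq m]
    (M : Matrix m m ℂ) (t : ℂ) :
    (1 + t • M).det = (M.charpoly.roots.map fun l => 1 + t * l).prod := by
  have hsplit : M.charpoly.Splits := IsAlgClosed.splits _
  have hcard := card_roots_charpoly M
  rcases eq_or_ne t 0 with rfl | ht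
  · simp
  have h1 : (1 + t • M : Matrix m m ℂ) = (-t) • (Matrix.scalar m (-t⁻¹) - M) := by
    ext i j
    rcases eq_or_ne i j with rfl | hij
    · simp only [Matrix.add_apply, Matrix.smul_apply, Matrix.sub_apply, Matrix.scalar_apply,
        Matrix.one_apply_eq, Matrix.diagonal_apply_eq, smul_eq_mul]
      field_simp
      ring
    · simp [hij]
  rw [h1, det_smul, ← eval_charpoly, hsplit.eval_eq_prod_roots_of_monic (charpoly_monic M),
    ← hcard, ← Multiset.prod_replicate, ← Multiset.map_const', ← Multiset.prod_map_mul]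
  refine congrArg Multiset.prod (Multiset.map_congr rfl fun l _ => ?_)
  field_simp
  ring

/-- A multiset of complex numbers with as many elements as a finite index type `m` is enumerated
by `m`: products over the multiset become products over `m`. [folklore] -/
theorem exists_enum_of_card_eq {m : Type*} [Fintype m] (S : Multiset ℂ)
    (hS : S.card = Fintype.card m) :
    ∃ d : m → ℂ, ∀ f : ℂ → ℂ, ∏ i, f (d i) = (S.map f).prod := by
  classical
  obtain ⟨e⟩ : Nonempty (m ≃ S.ToType) :=
    ⟨Fintype.equivOfCardEq (by rw [Multiset.card_coe]; exact hS.symm)⟩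
  refine ⟨fun i => ((e i : S.ToType) : ℂ), fun f => ?_⟩
  rw [Fintype.prod_equiv e (fun i => f ((e i : S.ToType) : ℂ)) (fun x => f (x : ℂ)) fun _ => rfl,
    Finset.prod_eq_multiset_prod, Multiset.map_univ]

/-- Spectral form of the one-colour scalar pencil: for a complex square matrix `M` there is an
enumeration `d` of its eigenvalues by its index type with `det (1 + t M) = ∏ i, (1 + t dᵢ)` for
every `t`. [folklore] -/
theorem exists_det_one_add_smul_eq_prod {m : Type*} [Fintype m] [DecidableEq m]
    (M : Matrix m m ℂ) : ∃ d : m → ℂ, ∀ t : ℂ, (1 + t • M).det = ∏ i, (1 + t * d i) := by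
  obtain ⟨d, hd⟩ := exists_enum_of_card_eq (m := m) M.charpoly.roots (card_roots_charpoly M)
  exact ⟨d, fun t => (det_one_add_smul_eq_prod_roots M t).trans (hd fun l => 1 + t * l).symm⟩

/-- If `∏ i, (1 + t dᵢ) ≠ 0` whenever `‖t‖ ≤ 2` then every `‖dᵢ‖ ≤ 1 / 2`: otherwise `t = -dᵢ⁻¹`
has norm `< 2` and kills the `i`-th factor. [folklore] -/
theorem norm_le_half_of_prod_ne_zero {m : Type*} [Fintype m] (d : m → ℂ)
    (h : ∀ t : ℂ, ‖t‖ ≤ 2 → ∏ i, (1 + t * d i) ≠ 0) (i : m) : ‖d i‖ ≤ 1 / 2 := by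
  by_contra hlt
  rw [not_le] at hlt
  have hdi : d i ≠ 0 := by
    rintro h0
    rw [h0, norm_zero] at hlt
    linarith
  refine h (-(d i)⁻¹) ?_ (Finset.prod_eq_zero (Finset.mem_univ i) ?_)
  · rw [norm_neg, norm_inv, inv_le_comm₀ (norm_pos_iff.mpr hdi) two_pos]
    linarith
  · rw [neg_mul, inv_mul_cancel₀ hdi, add_neg_cancel]

/-- Block decomposition of the scalar pencil: if `K i j = 0` whenever `r j < r i` then
`1 + diagonal w * K` is block triangular along `r`, and its determinant is the product over the
levels `a` of the determinants of the diagonal blocks `1 + diagonal (w|[r = a]) * K[r = a]`.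
[folklore] -/
theorem det_one_add_diagonal_mul_eq_prod_blocks {R : ℕ} (K : Matrix (Fin R) (Fin R) ℂ)
    (w : Fin R → ℂ) (r : Fin R → ℕ) (hK : ∀ i j : Fin R, r j < r i → K i j = 0) :
    (1 + diagonal w * K).det = ∏ a ∈ Finset.univ.image r,
      (1 + diagonal (fun x : {i // r i = a} => w x.1) * K.toSquareBlock r a).det := by
  have hBT : (1 + diagonal w * K).BlockTriangular r := by
    intro i j hij
    have hne : i ≠ j := by
      rintro rfl
      exact lt_irrefl _ hij
    simp [one_apply_ne hne, hK i j hij]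
  rw [hBT.det]
  refine Finset.prod_congr rfl fun a _ => ?_
  congr 1
  ext x y
  rcases eq_or_ne x y with rfl | hxy
  · simp [toSquareBlock_def]
  · have hxy' : x.1 ≠ y.1 := fun h => hxy (Subtype.ext h)
    simp [toSquareBlock_def, one_apply_ne hxy, one_apply_ne hxy']

/-- **Partial case (block-triangular support with monochrome diagonal blocks)** of the crux
`PriceOfContractivity`, line `birth`: if `K₀ i j = 0` whenever `r j < r i` for a rank function
`r : Fin R → ℕ` and the colouring `κ` is constant on the level sets of `r`, and the Sylvester
pencil `det (1 + diagonal (X ∘ κ) * K₀)` has no zero on the closed polydisc of radius `2`, then the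
same polynomial is `det (1 + diagonal (X ∘ κ₁) * K₁)` with `κ₁ = κ` and a diagonal `K₁` (the block
eigenvalues, row by row) of operator norm `≤ 1 / 2`. [folklore] -/
theorem stub_sameSize_monochromeBlocks :
    ∀ (R : ℕ) {σ : Type} (K₀ : Matrix (Fin R) (Fin R) ℂ) (κ : Fin R → σ),
      (∃ r : Fin R → ℕ, (∀ i j : Fin R, r j < r i → K₀ i j = 0) ∧ (∀ i j : Fin R, r i = r j → κ i = κ j)) →
      (∀ z : σ → ℂ, (∀ j, ‖z j‖ ≤ 2) → MvPolynomial.eval z (1 + Matrix.diagonal (fun i => MvPolynomial.X (κ i)) * K₀.map (fun a : ℂ => (MvPolynomial.C a : MvPolynomial σ ℂ))).det ≠ 0) →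
      ∃ (K₁ : Matrix (Fin R) (Fin R) ℂ) (κ₁ : Fin R → σ),
        ‖Matrix.toEuclideanCLM (𝕜 := ℂ) K₁‖ ≤ 1 / 2 ∧
        (1 + Matrix.diagonal (fun i => MvPolynomial.X (κ i)) * K₀.map (fun a : ℂ => (MvPolynomial.C a : MvPolynomial σ ℂ))).det =
          (1 + Matrix.diagonal (fun i => MvPolynomial.X (κ₁ i)) * K₁.map (fun a : ℂ => (MvPolynomial.C a : MvPolynomial σ ℂ))).det := by
  intro R σ K₀ κ hr hz
  obtain ⟨r, hK, hκ⟩ := hr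
  -- per-block enumerations of the eigenvalues of the diagonal blocks
  choose d hd using fun a : ℕ => exists_det_one_add_smul_eq_prod (K₀.toSquareBlock r a)
  -- glued into one diagonal, row by row
  obtain ⟨D, hD⟩ : ∃ D : Fin R → ℂ, ∀ (a : ℕ) (x : {i // r i = a}), D x.1 = d a x :=
    ⟨fun i => d (r i) ⟨i, rfl⟩, by
      rintro a ⟨i, rfl⟩
      rfl⟩
  -- the scalar pencil of `K₀` with weights constant on the blocks is the diagonal pencil of `D`
  have hdet : ∀ w : Fin R → ℂ, (∀ i j, r i = r j → w i = w j) →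
      (1 + diagonal w * K₀).det = ∏ i, (1 + w i * D i) := by
    intro w hw
    rw [det_one_add_diagonal_mul_eq_prod_blocks K₀ w r hK,
      ← Finset.prod_fiberwise_of_maps_to (s := Finset.univ) (t := Finset.univ.image r) (g := r)
        (fun i _ => Finset.mem_image_of_mem r (Finset.mem_univ i)) (fun i => 1 + w i * D i)]
    refine Finset.prod_congr rfl fun a ha => ?_
    obtain ⟨i₀, -, hi₀⟩ := Finset.mem_image.mp ha
    have hwc : (fun x : {i // r i = a} => w x.1) = fun _ => w i₀ :=
      funext fun x => hw x.1 i₀ (x.2.trans hi₀.symm)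
    rw [hwc, ← smul_eq_diagonal_mul, hd a (w i₀)]
    calc ∏ x : {i // r i = a}, (1 + w i₀ * d a x)
        = ∏ x : {i // r i = a}, (1 + w x.1 * D x.1) :=
          Fintype.prod_congr _ _ fun x => by rw [hD a x, hw x.1 i₀ (x.2.trans hi₀.symm)]
      _ = ∏ i ∈ Finset.univ.filter (fun i => r i = a), (1 + w i * D i) :=
          (Finset.prod_subtype (p := fun i => r i = a) (Finset.univ.filter fun i => r i = a)
            (fun x => by simp) (fun i => 1 + w i * D i)).symm
  -- zero-freeness at the constant points bounds the eigenvalues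
  have hDn : ∀ i, ‖D i‖ ≤ 1 / 2 := by
    refine norm_le_half_of_prod_ne_zero D (fun t ht => ?_)
    have h := hz (fun _ => t) (fun _ => ht)
    rw [Literature.Analysis.OperatorTheory.eval_det_one_add_diagonal_mul_map_C,
      hdet (fun _ => t) (fun _ _ _ => rfl)] at h
    exact h
  refine ⟨diagonal D, κ, ?_, ?_⟩
  · rw [Matrix.l2_opNorm_toEuclideanCLM, Matrix.l2_opNorm_diagonal]
    exact (pi_norm_le_iff_of_nonneg (by norm_num)).mpr hDn
  · refine MvPolynomial.funext fun z => ?_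
    rw [Literature.Analysis.OperatorTheory.eval_det_one_add_diagonal_mul_map_C,
      Literature.Analysis.OperatorTheory.eval_det_one_add_diagonal_mul_map_C,
      hdet (fun i => z (κ i)) (fun i j hij => by rw [hκ i j hij]), diagonal_mul_diagonal,
      ← diagonal_one, diagonal_add, det_diagonal]

end Summit.ValiantsHypothesis.ValiantsHypothesis.Theorems.PriceOfContractivity.MonochromeBlocks
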